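import Summits.NavierStokesRegularity.NavierStokesRegularity.Theorems.StrainDoorsNearFieldClosers
import HarnessLib

/-!
# StrainDoorsNearFieldKernel — the smoothly truncated far-field quadrupole kernel: smoothness, scaling and
# the uniform bounds `‖Dⁿ[(1−χ_r)K_e](y)‖ ≤ C / r^{3+n}` (`n ≤ 2`) — the KERNEL half of atom A2♭ «FarFieldEnergyBound»

ROUND-43/44 door D7♭ `NearFieldSubParityDoor` (`Theorems/StrainDoorsNearFieldDefs`, nsreg-p1 g33) reads the far field through
`farQuadS r u t x e = ∫ (1 − χ_r(y))·K_e(y)·f(u(t))(x+y) dy` with the smooth radial cutoff `χ_r(y) =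
smoothTransition(2 − |y|/r)` and the quadrupole kernel `K_e(y) = (3⟪y,e⟫² − |y|²)/|y|⁵`. Atom A2♭ asks
`|farQuadS_r| ≤ (C/r⁵)·E(u(t))` (two integrations by parts onto the velocity). This file supplies the KERNEL facts:

* `farKernel r e y := (1 − radialCutoff r y) * quadKernel e y`; `farQuadS … = ∫ farKernel r e y * qDensity u t (x+y)`;
* it vanishes on `|y| ≤ r`, equals `K_e` on `|y| ≥ 2r`, and SCALES: `farKernel r e y = r⁻³ · farKernel 1 e (r⁻¹ y)`;
* it is smooth on all of `ℝ³`, JOINTLY in `(e, y)` (`contDiff_farKernel_uncurry`, `contDiff_farKernel`);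
* ★ `exists_norm_iteratedFDeriv_farKernel_le`: ONE constant `C` with `‖iteratedFDeriv ℝ n (farKernel r e) y‖ ≤ C / r ^ (3 + n)`
  for all `n ≤ 2`, `r > 0`, unit `e` and all `y` (compactness on `{|e| = 1} × {|y| ≤ 3}` for the joint derivative, the
  degree-`(−3)` homogeneity of `K_e` for the tail `|y| ≥ 5/2`, and the scaling for general `r`).

Everything proved; no named facts; `--supports stmt-NavierStokesRegularity-0056 --as helper` (ns-s29-p2 g5; LEAD S-door ns-s30-p1 g4
key «A2♭», 2026-08-28T23:36:24Z). [folklore: Calderón–Zygmund kernels, homogeneity; Stein 1970 Ch. II §3.]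

HONEST FRAME: calculus of a fixed kernel, half of one true analytic atom (A2♭) of a CONDITIONAL regularity criterion (D7♭);
items 0056 `NoTypeII`, 10661 and NS regularity are NOT proved; nothing here is a route or a summit statement.
-/

noncomputable section

open MeasureTheory Set Function Filter Metric Real InnerProductSpace
open _root_.Topology
open scoped RealInnerProductSpace ContDiff

set_option linter.dupNamespace false

namespace Summit.NavierStokesRegularity.NavierStokesRegularity.Theorems.StrainDoors

/-! ## §1 The truncated kernel -/

/-- support (definition): the smoothly truncated far-field kernel `(1 − χ_r(y))·K_e(y)`. -/
def farKernel (r : ℝ) (e y : EuclideanSpace ℝ (Fin 3)) : ℝ :=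
  (1 - radialCutoff r y) * quadKernel e y

/-- `farQuadS` is the integral of `farKernel` against the translated Q-density. -/
theorem farQuadS_eq_integral_farKernel (r : ℝ) (u : ℝ → (EuclideanSpace ℝ (Fin 3)) → (EuclideanSpace ℝ (Fin 3)))
    (t : ℝ) (x e : EuclideanSpace ℝ (Fin 3)) :
    farQuadS r u t x e = ∫ y, farKernel r e y * qDensity u t (x + y) := rfl

/-- homogeneity of the quadrupole kernel: `K_e(s·y) = s⁻³·K_e(y)` for `s > 0` (all `y`, junk values included). -/
theorem quadKernel_smul (e y : EuclideanSpace ℝ (Fin 3)) {s : ℝ} (hs : 0 < s) :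
    quadKernel e (s • y) = s⁻¹ ^ 3 * quadKernel e y := by
  unfold quadKernel
  rw [real_inner_smul_left, norm_smul, Real.norm_of_nonneg hs.le]
  by_cases hy : y = 0
  · subst hy; simp
  · have hn : 0 < ‖y‖ := norm_pos_iff.2 hy
    field_simp

/-- the cutoff scales: `χ_r(y) = χ_1(y/r)`. -/
theorem radialCutoff_eq_one_smul {r : ℝ} (hr : 0 < r) (y : EuclideanSpace ℝ (Fin 3)) :
    radialCutoff r y = radialCutoff 1 (r⁻¹ • y) := by
  unfold radialCutoff
  rw [norm_smul, Real.norm_of_nonneg (inv_nonneg.2 hr.le), div_one, div_eq_inv_mul]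

/-- the truncated kernel vanishes on the ball `|y| ≤ r`. -/
theorem farKernel_eq_zero_of_le {r : ℝ} (hr : 0 < r) (e : EuclideanSpace ℝ (Fin 3)) {y : EuclideanSpace ℝ (Fin 3)}
    (hy : ‖y‖ ≤ r) : farKernel r e y = 0 := by
  rw [farKernel, radialCutoff_of_le hr hy, sub_self, zero_mul]

/-- the truncated kernel is the bare kernel beyond `2r`. -/
theorem farKernel_eq_quadKernel_of_ge {r : ℝ} (hr : 0 < r) (e : EuclideanSpace ℝ (Fin 3)) {y : EuclideanSpace ℝ (Fin 3)}
    (hy : 2 * r ≤ ‖y‖) : farKernel r e y = quadKernel e y := by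
  rw [farKernel, radialCutoff_of_ge hr hy, sub_zero, one_mul]

/-- **scaling**: `farKernel r e y = r⁻³ · farKernel 1 e (r⁻¹·y)`. -/
theorem farKernel_scale {r : ℝ} (hr : 0 < r) (e y : EuclideanSpace ℝ (Fin 3)) :
    farKernel r e y = r⁻¹ ^ 3 * farKernel 1 e (r⁻¹ • y) := by
  rw [farKernel, farKernel, radialCutoff_eq_one_smul hr, quadKernel_smul e y (inv_pos.2 hr)]
  rw [inv_inv]
  have hr3 : r⁻¹ ^ 3 * r ^ 3 = 1 := by rw [← mul_pow, inv_mul_cancel₀ hr.ne', one_pow]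
  calc (1 - radialCutoff 1 (r⁻¹ • y)) * quadKernel e y
      = (r⁻¹ ^ 3 * r ^ 3) * ((1 - radialCutoff 1 (r⁻¹ • y)) * quadKernel e y) := by rw [hr3, one_mul]
    _ = r⁻¹ ^ 3 * ((1 - radialCutoff 1 (r⁻¹ • y)) * (r ^ 3 * quadKernel e y)) := by ring

/-- the scaling as an identity of functions (composition with the dilation `r⁻¹ • id`). -/
theorem farKernel_eq_comp_smul {r : ℝ} (hr : 0 < r) (e : EuclideanSpace ℝ (Fin 3)) :
    farKernel r e = fun y => r⁻¹ ^ 3 * (farKernel 1 e ∘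
      ⇑(r⁻¹ • ContinuousLinearMap.id ℝ (EuclideanSpace ℝ (Fin 3)))) y := by
  funext y
  rw [farKernel_scale hr]
  rfl

/-- pointwise size: `|farKernel r e y| ≤ 2/r³` for a unit `e` (`0` inside `r`, `|K_e| ≤ 2/|y|³ ≤ 2/r³` outside). -/
theorem abs_farKernel_le {r : ℝ} (hr : 0 < r) {e : EuclideanSpace ℝ (Fin 3)} (he : ‖e‖ = 1)
    (y : EuclideanSpace ℝ (Fin 3)) : |farKernel r e y| ≤ 2 / r ^ 3 := by
  by_cases hy : ‖y‖ ≤ r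
  · rw [farKernel_eq_zero_of_le hr e hy, abs_zero]; positivity
  · have hry : r ≤ ‖y‖ := le_of_lt (not_le.1 hy)
    have h1 : |1 - radialCutoff r y| ≤ 1 := by
      have h0 : 0 ≤ radialCutoff r y := Real.smoothTransition.nonneg _
      have h1 : radialCutoff r y ≤ 1 := Real.smoothTransition.le_one _
      rw [abs_le]; constructor <;> linarith
    rw [farKernel, abs_mul]
    calc |1 - radialCutoff r y| * |quadKernel e y| ≤ 1 * (2 / r ^ 3) :=
          mul_le_mul h1 (abs_quadKernel_le_of_le he hr hry) (abs_nonneg _) zero_le_one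
      _ = 2 / r ^ 3 := one_mul _

/-! ## §2 Smoothness, jointly in `(e, y)` -/

/-- **joint smoothness**: `(e, y) ↦ farKernel 1 e y` is `C^n` on `ℝ³ × ℝ³` for every `n` (away from `y = 0` it is a smooth
expression; on `|y| < 1` it vanishes identically). -/
theorem contDiff_farKernel_uncurry {n : ℕ∞} :
    ContDiff ℝ n (fun p : EuclideanSpace ℝ (Fin 3) × EuclideanSpace ℝ (Fin 3) => farKernel 1 p.1 p.2) := by
  rw [contDiff_iff_contDiffAt]
  intro p
  by_cases hp : p.2 = 0
  · -- near `p` the kernel vanishes: `‖q.2‖ < 1 ⇒ χ_1(q.2) = 1`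
    have hev : (fun q : EuclideanSpace ℝ (Fin 3) × EuclideanSpace ℝ (Fin 3) => farKernel 1 q.1 q.2) =ᶠ[𝓝 p]
        fun _ => (0 : ℝ) := by
      have hopen : IsOpen {q : EuclideanSpace ℝ (Fin 3) × EuclideanSpace ℝ (Fin 3) | ‖q.2‖ < 1} :=
        isOpen_lt (continuous_norm.comp continuous_snd) continuous_const
      have hmem : p ∈ {q : EuclideanSpace ℝ (Fin 3) × EuclideanSpace ℝ (Fin 3) | ‖q.2‖ < 1} := by
        simp [hp]
      filter_upwards [hopen.mem_nhds hmem] with q hq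
      exact farKernel_eq_zero_of_le one_pos q.1 (le_of_lt hq)
    exact (contDiffAt_const.congr_of_eventuallyEq hev)
  · have hnorm : ContDiffAt ℝ n (fun q : EuclideanSpace ℝ (Fin 3) × EuclideanSpace ℝ (Fin 3) => ‖q.2‖) p :=
      (contDiffAt_norm ℝ hp).comp p contDiffAt_snd
    have hcut : ContDiffAt ℝ n (fun q : EuclideanSpace ℝ (Fin 3) × EuclideanSpace ℝ (Fin 3) =>
        1 - radialCutoff 1 q.2) p := by
      unfold radialCutoff
      exact contDiffAt_const.sub
        ((Real.smoothTransition.contDiff (n := n)).contDiffAt.comp p (contDiffAt_const.sub (hnorm.div_const 1)))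
    have hinner : ContDiffAt ℝ n (fun q : EuclideanSpace ℝ (Fin 3) × EuclideanSpace ℝ (Fin 3) => ⟪q.2, q.1⟫) p :=
      contDiffAt_snd.inner ℝ contDiffAt_fst
    have hK : ContDiffAt ℝ n (fun q : EuclideanSpace ℝ (Fin 3) × EuclideanSpace ℝ (Fin 3) =>
        quadKernel q.1 q.2) p := by
      unfold quadKernel
      refine ContDiffAt.div ((contDiffAt_const.mul (hinner.pow 2)).sub (hnorm.pow 2)) (hnorm.pow 5) ?_
      exact pow_ne_zero 5 (norm_ne_zero_iff.2 hp)
    exact hcut.mul hK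

/-- `farKernel 1 e` is `C^n` for each `e`. -/
theorem contDiff_farKernel_one {n : ℕ∞} (e : EuclideanSpace ℝ (Fin 3)) : ContDiff ℝ n (farKernel 1 e) := by
  have h := (contDiff_farKernel_uncurry (n := n)).comp
    (contDiff_prodMk_right (𝕜 := ℝ) (n := n) (E := EuclideanSpace ℝ (Fin 3)) e)
  exact h

/-- `farKernel r e` is `C^n` for every `r > 0` (scaling). -/
theorem contDiff_farKernel {n : ℕ∞} {r : ℝ} (hr : 0 < r) (e : EuclideanSpace ℝ (Fin 3)) :
    ContDiff ℝ n (farKernel r e) := by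
  rw [farKernel_eq_comp_smul hr e]
  exact contDiff_const.mul ((contDiff_farKernel_one e).comp (r⁻¹ • ContinuousLinearMap.id ℝ _).contDiff)

/-! ## §3 The uniform derivative bounds -/

/-- the partial iterated derivative in `y` is the joint one composed with the inclusion `y ↦ (0, y)`, hence no larger. -/
theorem norm_iteratedFDeriv_farKernel_one_le_uncurry {n : ℕ} (hn : n ≤ 2) (e y : EuclideanSpace ℝ (Fin 3)) :
    ‖iteratedFDeriv ℝ n (farKernel 1 e) y‖ ≤
      ‖iteratedFDeriv ℝ n (fun p : EuclideanSpace ℝ (Fin 3) × EuclideanSpace ℝ (Fin 3) => farKernel 1 p.1 p.2) (e, y)‖ := by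
  set F := fun p : EuclideanSpace ℝ (Fin 3) × EuclideanSpace ℝ (Fin 3) => farKernel 1 p.1 p.2 with hF
  set A := ContinuousLinearMap.inr ℝ (EuclideanSpace ℝ (Fin 3)) (EuclideanSpace ℝ (Fin 3)) with hA
  have hF2 : ContDiff ℝ 2 F := contDiff_farKernel_uncurry (n := 2)
  have hG : ContDiff ℝ 2 (fun q : EuclideanSpace ℝ (Fin 3) × EuclideanSpace ℝ (Fin 3) => F ((e, 0) + q)) :=
    hF2.comp (contDiff_const.add contDiff_id)
  have hfun : farKernel 1 e = (fun q : EuclideanSpace ℝ (Fin 3) × EuclideanSpace ℝ (Fin 3) => F ((e, 0) + q)) ∘ ⇑A := by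
    funext z
    simp [hF, hA]
  rw [hfun, ContinuousLinearMap.iteratedFDeriv_comp_right A hG y (by exact_mod_cast hn),
    iteratedFDeriv_comp_add_left]
  have hAe : (e, (0 : EuclideanSpace ℝ (Fin 3))) + A y = (e, y) := by simp [hA]
  rw [hAe]
  calc ‖(iteratedFDeriv ℝ n F (e, y)).compContinuousLinearMap fun _ => A‖
      ≤ ‖iteratedFDeriv ℝ n F (e, y)‖ * ∏ _i : Fin n, ‖A‖ :=
        ContinuousMultilinearMap.norm_compContinuousLinearMap_le _ _
    _ ≤ ‖iteratedFDeriv ℝ n F (e, y)‖ * 1 := by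
        refine mul_le_mul_of_nonneg_left ?_ (norm_nonneg _)
        refine Finset.prod_le_one (fun _ _ => norm_nonneg _) fun _ _ => ?_
        exact ContinuousLinearMap.norm_inr_le_one ℝ _ _
    _ = ‖iteratedFDeriv ℝ n F (e, y)‖ := mul_one _

/-- **compact part**: one constant bounds `‖Dⁿ(farKernel 1 e)(y)‖` (`n ≤ 2`) for all unit `e` and `|y| ≤ 3`. -/
theorem exists_norm_iteratedFDeriv_farKernel_one_le_of_le {n : ℕ} (hn : n ≤ 2) :
    ∃ C : ℝ, 0 ≤ C ∧ ∀ e : EuclideanSpace ℝ (Fin 3), ‖e‖ = 1 → ∀ y : EuclideanSpace ℝ (Fin 3), ‖y‖ ≤ 3 →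
      ‖iteratedFDeriv ℝ n (farKernel 1 e) y‖ ≤ C := by
  set F := fun p : EuclideanSpace ℝ (Fin 3) × EuclideanSpace ℝ (Fin 3) => farKernel 1 p.1 p.2 with hF
  have hcont : Continuous (iteratedFDeriv ℝ n F) :=
    (contDiff_farKernel_uncurry (n := 2)).continuous_iteratedFDeriv (by exact_mod_cast hn)
  have hK : IsCompact (Metric.closedBall (0 : EuclideanSpace ℝ (Fin 3)) 1 ×ˢ
      Metric.closedBall (0 : EuclideanSpace ℝ (Fin 3)) 3) :=
    (isCompact_closedBall 0 1).prod (isCompact_closedBall 0 3)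
  obtain ⟨C, hC⟩ := hK.exists_bound_of_continuousOn hcont.continuousOn
  refine ⟨max C 0, le_max_right _ _, fun e he y hy => ?_⟩
  have hmem : (e, y) ∈ Metric.closedBall (0 : EuclideanSpace ℝ (Fin 3)) 1 ×ˢ
      Metric.closedBall (0 : EuclideanSpace ℝ (Fin 3)) 3 := by
    simp only [Set.mem_prod, Metric.mem_closedBall, dist_zero_right]
    exact ⟨he.le, hy⟩
  exact ((norm_iteratedFDeriv_farKernel_one_le_uncurry hn e y).trans (hC _ hmem)).trans (le_max_left _ _)

/-- **the dilation step**: if `0 < s` then on the open region `2s < |y|` the kernel satisfies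
`farKernel 1 e y = s⁻³ · farKernel 1 e (s⁻¹ y)` (both sides are the bare `K_e`). -/
theorem farKernel_one_eq_of_lt {s : ℝ} (hs : 1 ≤ s) (e : EuclideanSpace ℝ (Fin 3)) {y : EuclideanSpace ℝ (Fin 3)}
    (hy : 2 * s < ‖y‖) : farKernel 1 e y = s⁻¹ ^ 3 * farKernel 1 e (s⁻¹ • y) := by
  have hs0 : 0 < s := lt_of_lt_of_le one_pos hs
  have h2 : 2 * (1 : ℝ) ≤ ‖y‖ := by nlinarith
  have h2' : 2 * (1 : ℝ) ≤ ‖s⁻¹ • y‖ := by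
    rw [norm_smul, Real.norm_of_nonneg (inv_nonneg.2 hs0.le)]
    rw [le_inv_mul_iff₀ hs0]
    linarith
  rw [farKernel_eq_quadKernel_of_ge one_pos e h2, farKernel_eq_quadKernel_of_ge one_pos e h2',
    quadKernel_smul e y (inv_pos.2 hs0), inv_inv, ← mul_assoc, ← mul_pow, inv_mul_cancel₀ hs0.ne', one_pow, one_mul]

/-- norm of the dilation `c • id`. -/
theorem norm_smul_id_le (c : ℝ) : ‖c • ContinuousLinearMap.id ℝ (EuclideanSpace ℝ (Fin 3))‖ ≤ |c| := by
  rw [norm_smul, Real.norm_eq_abs]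
  exact mul_le_of_le_one_right (abs_nonneg c) ContinuousLinearMap.norm_id_le

/-- iterated derivatives of `y ↦ a · g(c·y)`: `‖Dⁿ(a·g∘(c·))(y)‖ ≤ |a|·|c|ⁿ·‖Dⁿg(c·y)‖` for `g ∈ Cⁿ`. -/
theorem norm_iteratedFDeriv_const_mul_comp_smul_le {n : ℕ} {g : EuclideanSpace ℝ (Fin 3) → ℝ} (hg : ContDiff ℝ n g)
    (a c : ℝ) (y : EuclideanSpace ℝ (Fin 3)) :
    ‖iteratedFDeriv ℝ n (fun z => a * (g ∘ ⇑(c • ContinuousLinearMap.id ℝ (EuclideanSpace ℝ (Fin 3)))) z) y‖ ≤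
      |a| * |c| ^ n * ‖iteratedFDeriv ℝ n g (c • y)‖ := by
  set L := c • ContinuousLinearMap.id ℝ (EuclideanSpace ℝ (Fin 3)) with hL
  have hgL : ContDiff ℝ n (g ∘ ⇑L) := hg.comp L.contDiff
  have h1 : iteratedFDeriv ℝ n (fun z => a * (g ∘ ⇑L) z) y = a • iteratedFDeriv ℝ n (g ∘ ⇑L) y := by
    have := iteratedFDeriv_const_smul_apply' (a := a) (f := g ∘ ⇑L) (x := y) (hgL.contDiffAt)
    simpa only [smul_eq_mul] using this
  rw [h1, norm_smul, Real.norm_eq_abs, ContinuousLinearMap.iteratedFDeriv_comp_right L hg y le_rfl]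
  have hLy : L y = c • y := by simp [hL]
  rw [hLy, mul_assoc]
  refine mul_le_mul_of_nonneg_left ?_ (abs_nonneg a)
  calc ‖(iteratedFDeriv ℝ n g (c • y)).compContinuousLinearMap fun _ => L‖
      ≤ ‖iteratedFDeriv ℝ n g (c • y)‖ * ∏ _i : Fin n, ‖L‖ := ContinuousMultilinearMap.norm_compContinuousLinearMap_le _ _
    _ ≤ ‖iteratedFDeriv ℝ n g (c • y)‖ * |c| ^ n := by
        refine mul_le_mul_of_nonneg_left ?_ (norm_nonneg _)
        rw [Finset.prod_const, Finset.card_univ, Fintype.card_fin]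
        exact pow_le_pow_left₀ (norm_nonneg _) (norm_smul_id_le c) n
    _ = |c| ^ n * ‖iteratedFDeriv ℝ n g (c • y)‖ := mul_comm _ _

/-- **the `r = 1` bound, all `y`**: the compact bound on `|y| ≤ 3` extends to all `y` by the degree-`(−3)` homogeneity of the
tail (`|y| ≥ 5/2`: dilate by `s = |y|/(5/2) ≥ 1` onto the sphere of radius `5/2`). -/
theorem exists_norm_iteratedFDeriv_farKernel_one_le {n : ℕ} (hn : n ≤ 2) :
    ∃ C : ℝ, 0 ≤ C ∧ ∀ e : EuclideanSpace ℝ (Fin 3), ‖e‖ = 1 → ∀ y : EuclideanSpace ℝ (Fin 3),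
      ‖iteratedFDeriv ℝ n (farKernel 1 e) y‖ ≤ C := by
  obtain ⟨C, hC0, hC⟩ := exists_norm_iteratedFDeriv_farKernel_one_le_of_le hn
  refine ⟨C, hC0, fun e he y => ?_⟩
  by_cases hy : ‖y‖ ≤ 3
  · exact hC e he y hy
  · -- the tail: `s := |y| / (5/2) > 1`, `z := s⁻¹ y` has `|z| = 5/2`
    have hy3 : 3 < ‖y‖ := not_le.1 hy
    set s : ℝ := ‖y‖ / (5 / 2) with hs
    have hs1 : 1 ≤ s := by rw [hs, le_div_iff₀ (by norm_num)]; linarith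
    have hs0 : 0 < s := lt_of_lt_of_le one_pos hs1
    have hz : ‖s⁻¹ • y‖ = 5 / 2 := by
      rw [norm_smul, Real.norm_of_nonneg (inv_nonneg.2 hs0.le), hs, inv_div]
      field_simp
    -- near `y` the kernel is the dilated one
    have hev : farKernel 1 e =ᶠ[𝓝 y]
        fun z => s⁻¹ ^ 3 * (farKernel 1 e ∘ ⇑(s⁻¹ • ContinuousLinearMap.id ℝ (EuclideanSpace ℝ (Fin 3)))) z := by
      have hopen : IsOpen {z : EuclideanSpace ℝ (Fin 3) | 2 * s < ‖z‖} := isOpen_lt continuous_const continuous_norm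
      have hmem : y ∈ {z : EuclideanSpace ℝ (Fin 3) | 2 * s < ‖z‖} := by
        show 2 * s < ‖y‖
        rw [hs]; linarith
      filter_upwards [hopen.mem_nhds hmem] with z hz'
      rw [farKernel_one_eq_of_lt hs1 e hz']
      rfl
    rw [(hev.iteratedFDeriv ℝ n).eq_of_nhds]
    have hb := norm_iteratedFDeriv_const_mul_comp_smul_le (contDiff_farKernel_one (n := n) e) (s⁻¹ ^ 3) s⁻¹ y
    refine hb.trans ?_
    have hsle : |s⁻¹| ≤ 1 := by
      rw [abs_of_nonneg (inv_nonneg.2 hs0.le)]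
      exact inv_le_one_of_one_le₀ hs1
    have h3 : |s⁻¹ ^ 3| ≤ 1 := by rw [abs_pow]; exact pow_le_one₀ (abs_nonneg _) hsle
    have hn' : |s⁻¹| ^ n ≤ 1 := pow_le_one₀ (abs_nonneg _) hsle
    have hin : ‖iteratedFDeriv ℝ n (farKernel 1 e) (s⁻¹ • y)‖ ≤ C := hC e he _ (by rw [hz]; norm_num)
    calc |s⁻¹ ^ 3| * |s⁻¹| ^ n * ‖iteratedFDeriv ℝ n (farKernel 1 e) (s⁻¹ • y)‖ ≤ 1 * 1 * C := by
          gcongr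
      _ = C := by ring

/-- ★ **THE UNIFORM KERNEL BOUNDS** (A2♭, kernel half): one constant `C` with
`‖iteratedFDeriv ℝ n (farKernel r e) y‖ ≤ C / r ^ (3 + n)` for all `n ≤ 2`, `r > 0`, unit `e`, all `y`. -/
theorem exists_norm_iteratedFDeriv_farKernel_le {n : ℕ} (hn : n ≤ 2) :
    ∃ C : ℝ, 0 ≤ C ∧ ∀ r : ℝ, 0 < r → ∀ e : EuclideanSpace ℝ (Fin 3), ‖e‖ = 1 → ∀ y : EuclideanSpace ℝ (Fin 3),
      ‖iteratedFDeriv ℝ n (farKernel r e) y‖ ≤ C / r ^ (3 + n) := by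
  obtain ⟨C, hC0, hC⟩ := exists_norm_iteratedFDeriv_farKernel_one_le hn
  refine ⟨C, hC0, fun r hr e he y => ?_⟩
  rw [farKernel_eq_comp_smul hr e]
  have hb := norm_iteratedFDeriv_const_mul_comp_smul_le (contDiff_farKernel_one (n := n) e) (r⁻¹ ^ 3) r⁻¹ y
  refine hb.trans ?_
  have hri : |r⁻¹| = r⁻¹ := abs_of_nonneg (inv_nonneg.2 hr.le)
  rw [abs_pow, hri, ← pow_add, pow_add, div_eq_mul_inv, ← inv_pow, mul_comm C]
  have : r⁻¹ ^ (3 + n) = r⁻¹ ^ 3 * r⁻¹ ^ n := pow_add _ _ _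
  rw [← this]
  exact mul_le_mul_of_nonneg_left (hC e he _) (by positivity)

end Summit.NavierStokesRegularity.NavierStokesRegularity.Theorems.StrainDoors

end
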